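import Summits.Ventures.HodgeRepro2.T5FinitePlaceIsotropy
import Summits.Ventures.HodgeRepro2.T5FinitePlaceQuadraticStar
import Summits.Ventures.HodgeRepro2.T5FinitePlaceExistsOver
import Summits.Ventures.HodgeRepro2.T5FinitePlaceCM
import Summits.Ventures.HodgeRepro2.T5HasseMinkowskiDisplays

/-!
# The `(2n+1)`-ary quadratic space `⟨a, −aθ, −c⟩` is isotropic at EVERY finite place — O'Meara 63:19 is not needed
for the lane (cell pub-hodge-repro2, seat p3)

Tier-5 N2 support, rows N2.2.7 / N2.2.9 / N2.8.1 of route/T5-N2-route-3.md. Files 168 / 171 / 173 consume the display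
`OMeara1963_63_19 K⁺` (file 166: every quadratic space of dimension `≥ 5` over a local field is isotropic) at ONE
kind of space only — the `(2n+1)`-ary diagonal space `⟨a₁, −a₁θ, …, aₙ, −aₙθ, −c⟩` over `K⁺ = F`, `n ≥ 2`, with
`K = F(√θ)`, read at a finite place `v` of `F`. Its isotropy at `v` is a KERNEL fact of the lane, with no display:
* `isotropicDiag_datum_of_isSquare` — at a place where `θ` is a `v`-adic square `r²`, the vector with `r` at
  `a₁` and `1` at `−a₁θ` is isotropic (the binary piece `⟨a₁, −a₁θ⟩` is hyperbolic);
* `isotropicDiag_datum_of_not_isSquare` — at a non-split place, file 150's binary universality `(U)` on `E_w`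
  (`⟨a₁, a₂⟩` represents `c`: `star x · x · a₁ + star y · y · a₂ = c`) with `x = p₁ + q₁ √θ`, `y = p₂ + q₂ √θ`
  (file 147's `E_w = F_v + F_v √θ`, file 149's `star (p + q √θ) · (p + q √θ) = p² − θ q²`) gives the isotropic
  vector `(p₁, q₁, p₂, q₂, 1)` — the identity `a₁ (p₁² − θ q₁²) + a₂ (p₂² − θ q₂²) − c · 1² = 0` in `F_v`;
* **`isotropicDiag_datum_local`** — for a CM field `K` with the datum `(θ, y)` of file 161 (`θ = y²`,
  `star y = −y`), at EVERY finite place `v` of `K⁺` (file 153's place over `v`, the split / non-split dichotomy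
  of file 146), on `Sum.elim a (Sum.elim (−aθ) (−c))` with `#ι ≥ 2` — exactly the local hypothesis files 168 / 171
  / 173 took from 63:19.
Hence (files 176–178) Landherr's uniqueness in every rank, Shimura's Theorem 2.2 (i) and the N2 conclusions hold
modulo the Hasse–Minkowski display `OMeara1963_66_1 K⁺` ALONE: the display of 63:19 leaves the lane.

Mathlib + this seat's files 146 / 147 / 149 / 150 / 153 / 166 and their imports; no new display; no device.
§8(d): uses an L-value-free non-vanishing device: NO.
-/

namespace Summit.Ventures.HodgeRepro2.T5LocalIsotropyOfDatum

open IsDedekindDomain IsDedekindDomain.HeightOneSpectrum NumberField NumberField.IsCMField Module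
open Summit.Ventures.HodgeRepro2.T5HasseMinkowskiDisplays Summit.Ventures.HodgeRepro2.T5FinitePlaceStar
  Summit.Ventures.HodgeRepro2.T5FinitePlaceNormIndex Summit.Ventures.HodgeRepro2.T5FinitePlaceIsotropy
  Summit.Ventures.HodgeRepro2.T5FinitePlaceFourSquares

/-! The namespace `T5FinitePlaceLiesOver` is NOT opened (files 141–150): `algebraMap (v.adicCompletion F)
(w.adicCompletion E)` is seat p4's global instance throughout; file 147's decomposition, stated for this seat's
scoped instance, is transported along file 141's `algebraMap_apply'`. -/

/-! ## The split case: `⟨a₁, −a₁θ⟩` is hyperbolic -/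

section Split

variable {F : Type*} [Field F] [NumberField F] (v : HeightOneSpectrum (𝓞 F))

/-- At a place where `θ` is a `v`-adic square `r · r`, the datum space is isotropic: `r` at `a_{i₀}`, `1` at
`−a_{i₀} θ`, `0` elsewhere. -/
theorem isotropicDiag_datum_of_isSquare {ι : Type*} [Fintype ι] [DecidableEq ι] [Nonempty ι]
    (a : ι → F) (θ c₀ : F) (hsq : IsSquare (algebraMap F (v.adicCompletion F) θ)) :
    IsotropicDiag (v.adicCompletion F) fun j => algebraMap F (v.adicCompletion F)
      (Sum.elim a (Sum.elim (fun i => -(a i * θ)) (fun (_ : Unit) => -c₀)) j) := by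
  obtain ⟨r, hr⟩ := hsq
  obtain ⟨i₀⟩ := ‹Nonempty ι›
  refine ⟨Sum.elim (fun i => if i = i₀ then r else 0) (Sum.elim (fun i => if i = i₀ then 1 else 0) fun _ => 0),
    ?_, ?_⟩
  · intro h
    have := congrFun h (Sum.inr (Sum.inl i₀))
    simp at this
  · rw [Fintype.sum_sum_type, Fintype.sum_sum_type]
    simp only [Sum.elim_inl, Sum.elim_inr, ite_pow, Finset.sum_const_zero, mul_ite, mul_zero, mul_one,
      Finset.sum_ite_eq', Finset.mem_univ, if_true, ne_eq, OfNat.ofNat_ne_zero, not_false_eq_true, zero_pow,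
      add_zero, map_neg, map_mul, one_pow]
    rw [hr]
    ring

end Split

/-! ## The non-split case: binary universality on `E_w` -/

section NonSplit

variable {F E : Type*} [Field F] [NumberField F] [Field E] [NumberField E] [Algebra F E]
  [Algebra.IsQuadraticExtension F E]
variable (v : HeightOneSpectrum (𝓞 F)) (w : HeightOneSpectrum (𝓞 E)) [w.asIdeal.LiesOver v.asIdeal]
variable {s : E} {θ : F}
variable (hs : s ^ 2 = algebraMap F E θ) (hspan : Submodule.span F {(1 : E), s} = ⊤)
  (hsq : ¬ IsSquare (algebraMap F (v.adicCompletion F) θ)) (c : E ≃ₐ[F] E) (hc : c s = -s)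

include hs hspan hsq in
/-- **`E_w = F_v + F_v √θ`** for seat p4's structure map (file 147's decomposition transported along file 141's
`algebraMap_apply'`). -/
theorem exists_eq_add_mul_s' (y : w.adicCompletion E) :
    ∃ a b : v.adicCompletion F, y = algebraMap (v.adicCompletion F) (w.adicCompletion E) a +
      algebraMap (v.adicCompletion F) (w.adicCompletion E) b * algebraMap E (w.adicCompletion E) s := by
  obtain ⟨a, b, hab⟩ := T5FinitePlaceQuadraticStar.exists_eq_add_mul_s v w hs hspan hsq y
  refine ⟨a, b, ?_⟩
  rw [hab, algebraMap_apply' v w a, algebraMap_apply' v w b]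
  rfl

include w hs hspan hsq c hc in
/-- At a non-split place, the datum space is isotropic: `(U)` on `E_w` (file 150) represents `c` by
`⟨a_{i₁}, a_{i₂}⟩`, and the coordinates of the two vectors in the basis `1, √θ` of `E_w / F_v`, with `1` at `−c`,
form an isotropic vector of `⟨a, −aθ, −c⟩` over `F_v`. -/
theorem isotropicDiag_datum_of_not_isSquare {ι : Type*} [Fintype ι] [DecidableEq ι]
    (a : ι → F) (c₀ : F) (ha : ∀ i, a i ≠ 0) (hc₀ : c₀ ≠ 0) {i₁ i₂ : ι} (hne : i₁ ≠ i₂) :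
    IsotropicDiag (v.adicCompletion F) fun j => algebraMap F (v.adicCompletion F)
      (Sum.elim a (Sum.elim (fun i => -(a i * θ)) (fun (_ : Unit) => -c₀)) j) := by
  letI := localStarRing v w hs hspan hsq c hc
  have hU := binaryUniversal_of_nonsplit v w hs hspan hsq c hc
  set ι₁ : F →+* v.adicCompletion F := algebraMap F (v.adicCompletion F) with hι₁
  set ι₂ : v.adicCompletion F →+* w.adicCompletion E := algebraMap (v.adicCompletion F) (w.adicCompletion E)
    with hι₂
  have hA₁ : ι₂ (ι₁ (a i₁)) ≠ 0 := (map_ne_zero _).mpr ((map_ne_zero _).mpr (ha i₁))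
  have hA₂ : ι₂ (ι₁ (a i₂)) ≠ 0 := (map_ne_zero _).mpr ((map_ne_zero _).mpr (ha i₂))
  have hC : ι₂ (ι₁ c₀) ≠ 0 := (map_ne_zero _).mpr ((map_ne_zero _).mpr hc₀)
  obtain ⟨x, y, hxy⟩ := hU (ι₂ (ι₁ (a i₁))) (ι₂ (ι₁ (a i₂))) (ι₂ (ι₁ c₀))
    (star_algebraMap_left' v w hs hspan hsq c hc _) (star_algebraMap_left' v w hs hspan hsq c hc _)
    (star_algebraMap_left' v w hs hspan hsq c hc _) hA₁ hA₂ hC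
  obtain ⟨p₁, q₁, hx⟩ := exists_eq_add_mul_s' v w hs hspan hsq x
  obtain ⟨p₂, q₂, hy⟩ := exists_eq_add_mul_s' v w hs hspan hsq y
  rw [hx, hy, star_mul_self_add v w hs hspan hsq c hc, star_mul_self_add v w hs hspan hsq c hc] at hxy
  -- the identity in `F_v`
  have key : (p₁ ^ 2 - ι₁ θ * q₁ ^ 2) * ι₁ (a i₁) + (p₂ ^ 2 - ι₁ θ * q₂ ^ 2) * ι₁ (a i₂) = ι₁ c₀ := by
    apply ι₂.injective
    simpa only [map_add, map_mul] using hxy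
  refine ⟨Sum.elim (fun i => if i = i₁ then p₁ else if i = i₂ then p₂ else 0)
    (Sum.elim (fun i => if i = i₁ then q₁ else if i = i₂ then q₂ else 0) fun _ => 1), ?_, ?_⟩
  · intro h
    have := congrFun h (Sum.inr (Sum.inr ()))
    simp at this
  · rw [Fintype.sum_sum_type, Fintype.sum_sum_type]
    simp only [Sum.elim_inl, Sum.elim_inr, Fintype.sum_unique, one_pow, mul_one]
    rw [Finset.sum_eq_add i₁ i₂ hne (fun i _ hi => by simp [hi.1, hi.2]) (by simp) (by simp),
      Finset.sum_eq_add i₁ i₂ hne (fun i _ hi => by simp [hi.1, hi.2]) (by simp) (by simp)]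
    simp only [if_true, hne, if_false, hne.symm, map_neg, map_mul]
    linear_combination key

end NonSplit

/-! ## Every finite place of the maximal real subfield of a CM field -/

section CM

variable (K : Type*) [Field K] [NumberField K] [IsCMField K]
variable {θ : maximalRealSubfield K} {y : K}
variable (hθ : algebraMap (maximalRealSubfield K) K θ = y ^ 2) (hy : complexConj K y ≠ y)
variable (v : HeightOneSpectrum (𝓞 (maximalRealSubfield K)))

include hθ hy in
/-- **The datum space `⟨a, −aθ, −c⟩` over `K⁺` is isotropic at EVERY finite place `v` of `K⁺`** (`#ι ≥ 2`, all
`aᵢ ≠ 0`, `c ≠ 0`): split places by `isotropicDiag_datum_of_isSquare`, non-split ones by `(U)` on `K_w` for a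
place `w` of `K` over `v` (file 153's `exists_liesOver`). This is the only use files 168 / 171 / 173 make of the
display `OMeara1963_63_19 K⁺`. -/
theorem isotropicDiag_datum_local {ι : Type*} [Fintype ι] [DecidableEq ι] (hcard : 2 ≤ Fintype.card ι)
    (a : ι → maximalRealSubfield K) (c₀ : maximalRealSubfield K) (ha : ∀ i, a i ≠ 0) (hc₀ : c₀ ≠ 0) :
    IsotropicDiag (v.adicCompletion (maximalRealSubfield K)) fun j =>
      algebraMap (maximalRealSubfield K) (v.adicCompletion (maximalRealSubfield K))
        (Sum.elim a (Sum.elim (fun i => -(a i * θ)) (fun (_ : Unit) => -c₀)) j) := by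
  by_cases hsq : IsSquare (algebraMap (maximalRealSubfield K) (v.adicCompletion (maximalRealSubfield K)) θ)
  · haveI : Nonempty ι := Fintype.card_pos_iff.mp (by omega)
    exact isotropicDiag_datum_of_isSquare v a θ c₀ hsq
  · obtain ⟨w, hw⟩ := T5FinitePlaceExistsOver.exists_liesOver K v
    obtain ⟨i₁, i₂, hne⟩ := Fintype.exists_pair_of_one_lt_card (by omega : 1 < Fintype.card ι)
    exact isotropicDiag_datum_of_not_isSquare v w hθ.symm (T5FinitePlaceCM.span_pair_eq_top K hy) hsq
      (complexConj K) (T5FinitePlaceCM.complexConj_apply_eq_neg K hθ hy) a c₀ ha hc₀ hne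

end CM

end Summit.Ventures.HodgeRepro2.T5LocalIsotropyOfDatum
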